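import Literature.Geometry.Riemannian.GurskyViaclovskyClosednessBootstrapAux
import Literature.Geometry.Riemannian.GurskyViaclovskyClosednessExtraction
import Literature.Geometry.Riemannian.GurskyViaclovskyCovariantBoundsNaturality
import Literature.Analysis.PDE.EllipticSmoothBootstrap
import HarnessLib

/-!
# Gursky–Viaclovsky closedness: the Schauder bootstrap in the charts — the named fact from a
# uniform chart `C^{2,α}` bound

Support file (everything PROVED; no definition, no named fact) for the named fact
`Literature.Geometry.Riemannian.gurskyViaclovsky_pathClosed_weighted_four`
(Gursky–Viaclovsky, J. Differential Geom. 63 (2003), Prop. 6 and §5: the solvable set of the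
Weyl-weighted `σ₂` continuity path is closed). `GurskyViaclovskyClosednessExtraction.lean`
reduced the fact to uniform chart bounds of all orders `m ≥ 3` for `C²`-bounded sequences of
smooth admissible background solutions (`pathClosed_of_chartHigherBounds`), i.e. to the interior
a priori estimate "uniform `C²` bounds and the equation give uniform `Cᵐ` bounds". That estimate
is Evans–Krylov (`C² ⇒ C^{2,α}`, Gilbarg–Trudinger Thm. 17.14) followed by the Schauder
bootstrap (`C^{2,α} ⇒ Cᵐ` for all `m`, Gilbarg–Trudinger Lemma 17.16). This file performs the
SECOND step inside the tree, so that what remains assumed of the printed proof is exactly the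
Evans–Krylov Hölder estimate of the second derivatives:

* `chart_uniform_bounds_of_holderOnWith_two` — on a closed Riemannian `4`-manifold, for a
  `C²`-bounded sequence of smooth admissible solutions of
  `backgroundPathOperator g s_k (−u_k) = q e^{4u_k}`, `s_k → t`, `s_k ≤ 1`, whose chart
  representatives `u_k ∘ (chartAt c)⁻¹` have uniformly `α`-Hölder second derivatives on a chart
  ball at `c`, the representatives obey uniform bounds of EVERY order on a smaller chart ball:
  the chart equation is the jet equation `G(y, s_k, cjet₂U_k(y)) = 0` of
  `GurskyViaclovskyClosednessBootstrapAux.lean`, smooth in `(y, s, J)`, uniformly elliptic along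
  the solutions with a constant depending only on `(min q, C, sup|Ric|, sup|R|, sup|s_k|)` and the
  chart (`le_fderiv_jetOperator_single`, the transport of the fact's covariant hypotheses to the
  chart metric by `backgroundPathOperator_comap`, `backgroundScalar_comap`, `gradSq_comap`,
  `normSq_hessian_comap`, `normSq_ricci_comap`, `scalarCurvature_comap_cn`), the orders `≤ 2` are
  bounded by `chart_iteratedFDeriv_bounds_le_two`, and the abstract a-priori Lemma 17.16
  `Literature.Analysis.PDE.uniform_iteratedFDeriv_bounds_of_holder_two` applies;
* `pathClosed_of_chartC2alphaBounds` — **the named fact follows from a uniform chart `C^{2,α}`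
  Hölder bound** for the fact's solution sequences (the Evans–Krylov estimate, Gursky–Viaclovsky
  Prop. 6 / Gilbarg–Trudinger Thm. 17.14, assumed inline as `hC2α`; NOT proved in the tree and
  not vended as a fact).

## References

* M. J. Gursky, J. A. Viaclovsky, J. Differential Geom. 63 (2003) 131–154, Prop. 6, §5.
  [GurskyViaclovsky2003]
* D. Gilbarg, N. S. Trudinger, *Elliptic Partial Differential Equations of Second Order* (2001),
  Thm. 17.14, Lemma 17.16. [GilbargTrudinger2001]
-/

noncomputable section

set_option maxSynthPendingDepth 3

open scoped Manifold ContDiff Topology NNReal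
open Set Filter Metric Function Module

namespace Literature.Geometry.Riemannian.GurskyViaclovskyPath

open Literature.Geometry.Lorentzian (PseudoRiemannianMetric)
open Literature.Geometry.Lorentzian.PseudoRiemannianMetric
open Literature.Geometry.Lorentzian
open Literature.Geometry.Lorentzian.MetricCoord
open Literature.Analysis.Calculus Literature.Analysis.PDE

/-! ### Uniform chart bounds of all orders from a uniform chart `C^{2,α}` bound -/

section Chart

variable {M : Type*} [TopologicalSpace M] [ChartedSpace (EuclideanSpace ℝ (Fin 4)) M]
  [IsManifold (𝓡 4) ∞ M]
  (g : PseudoRiemannianMetric (𝓡 4) ∞ (EuclideanSpace ℝ (Fin 4)) (TangentSpace (𝓡 4) : M → Type _))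
  [g.HasLeviCivita]

/-- **The Schauder bootstrap in a chart** (Gilbarg–Trudinger 2001, Lemma 17.16, for the chart
form of the weighted `σ₂` path equation). On a closed Riemannian `4`-manifold let `u_k` be smooth
with `backgroundPathOperator g s_k (−u_k) = q e^{4u_k}` (`q > 0` smooth), `backgroundScalar
g (−u_k) > 0`, `s_k → t`, `s_k ≤ 1`, and `|u_k|, |∇u_k|²_g, |∇²u_k|²_g ≤ C`. If on a chart ball
`B(chartAt c c, r₁)` the second derivatives of the representatives `U_k = u_k ∘ (chartAt c)⁻¹`
are `α`-Hölder uniformly in `k` (`0 < α < 1`), then on some smaller chart ball inside the chart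
target every derivative `DᵐU_k` is bounded uniformly in `k`: the `U_k` solve the smooth jet
equation `G(y, s_k, cjet₂U_k(y)) = 0` (`jetOperator_cjetOf_eq_zero`), uniformly elliptic along
the solutions (`le_fderiv_jetOperator_single`, constants from `min q`, `C`, `sup |Ric_g|²`,
`sup |R_g|`, `sup |s_k|` and the chart), with uniform `C²` bounds
(`chart_iteratedFDeriv_bounds_le_two`), so the abstract bootstrap
`uniform_iteratedFDeriv_bounds_of_holder_two` applies. [cite: GilbargTrudinger2001, Lemma 17.16] -/
theorem chart_uniform_bounds_of_holderOnWith_two [CompactSpace M] (hg : g.IsRiemannian)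
    {q : M → ℝ} {C : ℝ} (hq : ContMDiff (𝓡 4) 𝓘(ℝ) ∞ q) (hq0 : ∀ x, 0 < q x) {s : ℕ → ℝ} {t : ℝ}
    (hs : Tendsto s atTop (𝓝 t)) (hs1 : ∀ k, s k ≤ 1) {u : ℕ → M → ℝ}
    (hu : ∀ k, ContMDiff (𝓡 4) 𝓘(ℝ) ∞ (u k))
    (heq : ∀ k x, backgroundPathOperator g (s k) (fun y ↦ -u k y) x =
      q x * Real.exp (-4 * (-u k x)))
    (hpos : ∀ k x, 0 < backgroundScalar g (fun y ↦ -u k y) x)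
    (hbd : ∀ k x, |u k x| ≤ C ∧ g.gradSq (u k) x ≤ C ∧ g.normSq x (g.hessian (u k) x) ≤ C)
    (c : M) {r₁ : ℝ} (hr₁ : 0 < r₁) {α : ℝ≥0} (hα0 : 0 < α) (hα1 : α < 1) {BH : ℝ≥0}
    (hho : ∀ k, HolderOnWith BH α
      (iteratedFDeriv ℝ 2 (fun z ↦ u k ((chartAt (EuclideanSpace ℝ (Fin 4)) c).symm z)))
      (ball (chartAt (EuclideanSpace ℝ (Fin 4)) c c) r₁)) :
    ∃ r : ℝ, 0 < r ∧
      ball (chartAt (EuclideanSpace ℝ (Fin 4)) c c) r ⊆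
        (chartAt (EuclideanSpace ℝ (Fin 4)) c).target ∧
      ∀ m : ℕ, ∃ B : ℝ, ∀ k, ∀ y ∈ ball (chartAt (EuclideanSpace ℝ (Fin 4)) c c) r,
        ‖iteratedFDeriv ℝ m (fun z ↦ u k ((chartAt (EuclideanSpace ℝ (Fin 4)) c).symm z)) y‖
          ≤ B := by
  classical
  -- the inverse chart at `c` and the pulled-back metric
  set U : TopologicalSpace.Opens (EuclideanSpace ℝ (Fin 4)) :=
    ⟨(chartAt (EuclideanSpace ℝ (Fin 4)) c).target,
      (chartAt (EuclideanSpace ℝ (Fin 4)) c).open_target⟩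
  set Φ : U → M := fun u ↦ (chartAt (EuclideanSpace ℝ (Fin 4)) c).symm u
  have hΦ : ContMDiff 𝓘(ℝ, EuclideanSpace ℝ (Fin 4)) 𝓘(ℝ, EuclideanSpace ℝ (Fin 4)) (∞ + 1) Φ :=
    ChartInverseSelf.contMDiff_symm c
  have hΦ' : ∀ u, Function.Injective
      (mfderiv 𝓘(ℝ, EuclideanSpace ℝ (Fin 4)) 𝓘(ℝ, EuclideanSpace ℝ (Fin 4)) Φ u) :=
    ChartInverseSelf.injective_mfderiv_symm c
  have hdim : Module.finrank ℝ (EuclideanSpace ℝ (Fin 4)) =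
      Module.finrank ℝ (EuclideanSpace ℝ (Fin 4)) := rfl
  have hE : finrank ℝ (EuclideanSpace ℝ (Fin 4)) = 4 := finrank_euclideanSpace_fin
  have hn : (2 : ℕ∞ω) ≤ ((⊤ : ℕ∞) : ℕ∞ω) := WithTop.coe_le_coe.mpr le_top
  have hpb : contMDiff_pullbackBilin 𝓘(ℝ, EuclideanSpace ℝ (Fin 4)) M
      𝓘(ℝ, EuclideanSpace ℝ (Fin 4)) U ∞ := contMDiff_pullbackBilin_holds
  set gU := g.comap hpb Φ hΦ hΦ' hdim
  haveI : gU.HasLeviCivita := gU.hasLeviCivita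
  set G : EuclideanSpace ℝ (Fin 4) →
      EuclideanSpace ℝ (Fin 4) →L[ℝ] EuclideanSpace ℝ (Fin 4) →L[ℝ] ℝ :=
    Function.extend (Subtype.val : U → EuclideanSpace ℝ (Fin 4))
      (fun y : U ↦ (gU.val y :
        EuclideanSpace ℝ (Fin 4) →L[ℝ] EuclideanSpace ℝ (Fin 4) →L[ℝ] ℝ)) (fun _ ↦ 0) with hGdef
  have hG : ∀ y : U, gU.val y = G y := fun y ↦ by
    rw [hGdef, Subtype.val_injective.extend_apply]
  have hmet : MetricCoord.IsMetricOn G (U : Set (EuclideanSpace ℝ (Fin 4))) :=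
    OpensChart.isMetricOn_repr hG
  have hgUR : gU.IsRiemannian := fun z v hv ↦ by
    have h1 : gU.val z v v = g.val (Φ z)
        (mfderiv 𝓘(ℝ, EuclideanSpace ℝ (Fin 4)) 𝓘(ℝ, EuclideanSpace ℝ (Fin 4)) Φ z v)
        (mfderiv 𝓘(ℝ, EuclideanSpace ℝ (Fin 4)) 𝓘(ℝ, EuclideanSpace ℝ (Fin 4)) Φ z v) := rfl
    rw [h1]
    exact hg _ _ fun h0 ↦ hv ((hΦ' z) (by
      rw [h0]
      exact ((mfderiv 𝓘(ℝ, EuclideanSpace ℝ (Fin 4)) 𝓘(ℝ, EuclideanSpace ℝ (Fin 4)) Φ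
        z).map_zero).symm))
  -- the chart representatives
  set Uk : ℕ → EuclideanSpace ℝ (Fin 4) → ℝ :=
    fun k z ↦ u k ((chartAt (EuclideanSpace ℝ (Fin 4)) c).symm z)
  have hUk : ∀ k, ContDiffOn ℝ ∞ (Uk k) (chartAt (EuclideanSpace ℝ (Fin 4)) c).target := fun k ↦
    contDiffOn_comp_chart_symm (hu k) c Subset.rfl
  have h2top : (2 : WithTop ℕ∞) ≤ ∞ := WithTop.coe_le_coe.mpr le_top
  have hUk2 : ∀ k (y : U), ContDiffAt ℝ 2 (Uk k) y := fun k y ↦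
    (ChartInverseSelf.contDiffAt_comp_symm c (hu k) y.2).of_le h2top
  have hf : ∀ k, ContMDiff 𝓘(ℝ, EuclideanSpace ℝ (Fin 4)) 𝓘(ℝ) ∞ (u k ∘ Φ) := fun k ↦
    (hu k).comp (hΦ.of_le le_self_add)
  have hfF : ∀ k (y : U), (u k ∘ Φ) y = Uk k y := fun _ _ ↦ rfl
  -- the Weyl term and the right-hand side in the chart
  set W : EuclideanSpace ℝ (Fin 4) → ℝ :=
    fun z ↦ g.weylNormSq ((chartAt (EuclideanSpace ℝ (Fin 4)) c).symm z)
  have hWy : ∀ y : U, W y = gU.weylNormSq y := fun y ↦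
    (g.weylNormSq_comap hpb hΦ hΦ' hdim hg y).symm
  have hW : ContDiffOn ℝ ∞ W (U : Set (EuclideanSpace ℝ (Fin 4))) :=
    contDiffOn_of_eq_weylNormSq gU hG hgUR hWy
  set Q : EuclideanSpace ℝ (Fin 4) → ℝ :=
    fun z ↦ q ((chartAt (EuclideanSpace ℝ (Fin 4)) c).symm z)
  have hQ : ContDiffOn ℝ ∞ Q (U : Set (EuclideanSpace ℝ (Fin 4))) :=
    contDiffOn_comp_chart_symm hq c Subset.rfl
  -- the fact's hypotheses transported to the chart metric
  have heqU : ∀ k (y : U), backgroundPathOperator gU (s k) (fun z ↦ -(u k ∘ Φ) z) y =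
      Q y * Real.exp (-4 * (-(u k ∘ Φ) y)) := fun k y ↦
    (backgroundPathOperator_comap g hpb hΦ hΦ' hdim hg (w := fun m ↦ -u k m) (hu k).neg
      (s k) y).trans (heq k (Φ y))
  have hposU : ∀ k (y : U), 0 < backgroundScalar gU (fun z ↦ -(u k ∘ Φ) z) y := fun k y ↦ by
    have h := backgroundScalar_comap g hpb hΦ hΦ' hdim hg (w := fun m ↦ -u k m) (hu k).neg y
    exact (hpos k (Φ y)).trans_eq h.symm
  have hfyU : ∀ k (y : U), |(u k ∘ Φ) y| ≤ C := fun k y ↦ (hbd k (Φ y)).1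
  have hgradU : ∀ k (y : U), gU.gradSq (u k ∘ Φ) y ≤ C := fun k y ↦
    (gradSq_comap g hpb hΦ hΦ' hdim hg (hu k) y).trans_le (hbd k _).2.1
  have hhessU : ∀ k (y : U), gU.normSq y (gU.hessian (u k ∘ Φ) y) ≤ C := fun k y ↦
    (normSq_hessian_comap g hpb hΦ hΦ' hdim (hu k) y).trans_le (hbd k _).2.2
  -- the constants: `C ≥ 0`, `q ≥ q₀ > 0`, `|s_k| ≤ T`, `|Ric|² ≤ P²`, `|R| ≤ P`
  have hC0 : 0 ≤ C := (abs_nonneg _).trans (hbd 0 c).1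
  obtain ⟨x₀, -, hx₀⟩ :=
    isCompact_univ.exists_isMinOn ⟨c, mem_univ c⟩ hq.continuous.continuousOn
  have hq₀ : 0 < q x₀ := hq0 x₀
  have hqy : ∀ x, q x₀ ≤ q x := fun x ↦ isMinOn_iff.1 hx₀ x (mem_univ x)
  obtain ⟨T, hT⟩ : ∃ T : ℝ, ∀ k, ‖s k‖ ≤ T := by
    obtain ⟨T, hT⟩ := (Metric.isBounded_range_of_tendsto s hs).exists_norm_le
    exact ⟨T, fun k ↦ hT _ (mem_range_self k)⟩
  have hsT : ∀ k, |s k| ≤ T := fun k ↦ (Real.norm_eq_abs (s k)).symm.trans_le (hT k)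
  have hT0 : 0 ≤ T := (abs_nonneg _).trans (hsT 0)
  obtain ⟨P₁, hP₁⟩ := isCompact_univ.exists_bound_of_continuousOn
    (g.contMDiff_normSq_ricci').continuous.continuousOn
  obtain ⟨P₂, hP₂⟩ := isCompact_univ.exists_bound_of_continuousOn
    g.contMDiff_scalarCurvature.continuous.continuousOn
  set P : ℝ := Real.sqrt P₁ + |P₂|
  have hP0 : 0 ≤ P := by positivity
  have hP₁0 : 0 ≤ P₁ := (norm_nonneg _).trans (hP₁ c (mem_univ c))
  have hP₁P : P₁ ≤ P ^ 2 := by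
    calc P₁ = Real.sqrt P₁ ^ 2 := (Real.sq_sqrt hP₁0).symm
      _ ≤ P ^ 2 :=
          pow_le_pow_left₀ (Real.sqrt_nonneg _) (le_add_of_nonneg_right (abs_nonneg _)) 2
  have hRicU : ∀ y : U, gU.normSq y (gU.ricci y) ≤ P ^ 2 := fun y ↦
    (normSq_ricci_comap g hpb hΦ hΦ' hdim y).trans_le
      (((Real.le_norm_self _).trans (hP₁ (Φ y) (mem_univ _))).trans hP₁P)
  have hRU : ∀ y : U, |gU.scalarCurvature y| ≤ P := fun y ↦ by
    have h0 : gU.scalarCurvature y = g.scalarCurvature (Φ y) :=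
      g.scalarCurvature_comap_cn hpb hΦ hΦ' hdim hn y
    have h1 := hP₂ (Φ y) (mem_univ _)
    rw [Real.norm_eq_abs] at h1
    rw [h0]
    exact h1.trans ((le_abs_self _).trans (le_add_of_nonneg_left (Real.sqrt_nonneg _)))
  -- the radii
  set yc : EuclideanSpace ℝ (Fin 4) := chartAt (EuclideanSpace ℝ (Fin 4)) c c
  have hycT : yc ∈ (chartAt (EuclideanSpace ℝ (Fin 4)) c).target :=
    (chartAt (EuclideanSpace ℝ (Fin 4)) c).map_source (mem_chart_source _ c)
  obtain ⟨r₂, hr₂, -, h₂⟩ := chart_iteratedFDeriv_bounds_le_two g hg hu hbd c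
  obtain ⟨B₀, hB₀⟩ := h₂ 0 (by norm_num)
  obtain ⟨B₁, hB₁⟩ := h₂ 1 (by norm_num)
  obtain ⟨B₂, hB₂⟩ := h₂ 2 le_rfl
  obtain ⟨r₃, hr₃, hr₃T⟩ := Metric.isOpen_iff.1 (chartAt (EuclideanSpace ℝ (Fin 4)) c).open_target
    yc hycT
  set R : ℝ := min (min r₁ r₂) (r₃ / 2)
  have hR : 0 < R := lt_min (lt_min hr₁ hr₂) (half_pos hr₃)
  have hRO : closedBall yc R ⊆ (chartAt (EuclideanSpace ℝ (Fin 4)) c).target :=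
    (closedBall_subset_closedBall (min_le_right _ _)).trans
      ((closedBall_subset_ball (half_lt_self hr₃)).trans hr₃T)
  have hR₁ : ball yc R ⊆ ball yc r₁ := ball_subset_ball ((min_le_left _ _).trans (min_le_left _ _))
  have hR₂ : ball yc R ⊆ ball yc r₂ :=
    ball_subset_ball ((min_le_left _ _).trans (min_le_right _ _))
  -- frame constants on the compact ball and the ellipticity constant
  obtain ⟨κ, Λg, hκ, hΛg, hframe⟩ :=
    exists_frame_bounds gU hG hgUR (isCompact_closedBall yc R) hRO
  set l : ℝ := 4 * (q x₀ * Real.exp (-4 * C) / 4 /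
      (2 * (4 * ((1 + T) * P + (3 + 2 * T) * Real.sqrt C + (5 + 2 * T) * C) + 1))) /
    ((Λg * κ) ^ 2 * 4)
  have hl : 0 < l := by positivity
  -- the jet function
  set bE : OrthonormalBasis (Fin 4) ℝ (EuclideanSpace ℝ (Fin 4)) :=
    EuclideanSpace.basisFun (Fin 4) ℝ
  set Ggv : EuclideanSpace ℝ (Fin 4) × ℝ × CJet (Fin 4) 2 → ℝ := fun x ↦
    chartOperator G x.2.1 (W x.1) x.1 (pOf bE x.2.2) (rOf bE x.2.2) -
      Q x.1 * Real.exp (4 * x.2.2 0 Fin.elim0)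
  have hGgv : ContDiffOn ℝ ∞ Ggv {x | x.1 ∈ (chartAt (EuclideanSpace ℝ (Fin 4)) c).target} :=
    contDiffOn_jetOperator bE hmet hW hQ
  -- the equation and the uniform ellipticity on the ball
  have heq' : ∀ k, ∀ y ∈ ball yc R, Ggv (y, s k, cjetOf bE 2 (Uk k) y) = 0 := fun k y hy ↦ by
    have hyU : y ∈ (chartAt (EuclideanSpace ℝ (Fin 4)) c).target := hRO (ball_subset_closedBall hy)
    exact jetOperator_cjetOf_eq_zero gU hG hgUR bE (s k) (hf k) (hfF k) ⟨y, hyU⟩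
      (hUk2 k ⟨y, hyU⟩) (hWy ⟨y, hyU⟩) (heqU k ⟨y, hyU⟩)
  have hell : ∀ k, ∀ y ∈ ball yc R, ∀ η : EuclideanSpace ℝ (Fin 4) →L[ℝ] ℝ,
      l * ‖η‖ ^ 2 ≤ fderiv ℝ Ggv (y, s k, cjetOf bE 2 (Uk k) y)
        ((0 : EuclideanSpace ℝ (Fin 4)), (0 : ℝ), Pi.single (Fin.last 2)
          (fun I : Fin 2 → Fin 4 => η (bE (I 0)) * η (bE (I 1)))) := fun k y hy η ↦ by
    have hyK : y ∈ closedBall yc R := ball_subset_closedBall hy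
    have hyU : y ∈ (chartAt (EuclideanSpace ℝ (Fin 4)) c).target := hRO hyK
    set y' : U := ⟨y, hyU⟩
    obtain ⟨b, hb⟩ := gU.exists_basis_isOrthonormalFrame (x := y') (fun v hv ↦ hgUR y' v hv) hE
    obtain ⟨hΛy, hκb⟩ := hframe y' hyK
    exact le_fderiv_jetOperator_single gU hG hgUR bE hW hQ (hf k) (hfF k) (q := fun z : U ↦ Q z)
      (hs1 k) (hsT k) hq₀ hC0 hP0 y' (hUk2 k y') (hqy _) (heqU k y') (hposU k y') (hfyU k y')
      (hgradU k y') (hhessU k y') (hRicU y') (hRU y') hb hκ.le (hκb hb) hΛy η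
  -- uniform `C²` bounds and the Hölder bound, with one constant
  set Bm : ℝ := max (max B₀ (max B₁ B₂)) (BH : ℝ)
  have hbd' : ∀ k, ∀ y ∈ ball yc R, ∀ j ≤ 2, ‖iteratedFDeriv ℝ j (Uk k) y‖ ≤ Bm := by
    intro k y hy j hj
    interval_cases j
    · exact (hB₀ k y (hR₂ hy)).trans ((le_max_left _ _).trans (le_max_left _ _))
    · exact (hB₁ k y (hR₂ hy)).trans
        (((le_max_left _ _).trans (le_max_right _ _)).trans (le_max_left _ _))
    · exact (hB₂ k y (hR₂ hy)).trans
        (((le_max_right _ _).trans (le_max_right _ _)).trans (le_max_left _ _))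
  have hho' : ∀ k, HolderOnWith Bm.toNNReal α (iteratedFDeriv ℝ 2 (Uk k)) (ball yc R) := fun k ↦
    ((hho k).mono hR₁).mono_const (NNReal.le_toNNReal_of_coe_le (le_max_right _ _))
  -- the abstract bootstrap
  have key := uniform_iteratedFDeriv_bounds_of_holder_two (P := ℝ) bE
    (chartAt (EuclideanSpace ℝ (Fin 4)) c).open_target hGgv hR hRO hα0 hα1 hl hT hUk heq' hell
    hbd' hho'
  exact ⟨R / 2, half_pos hR,
    (ball_subset_ball (half_le_self hR.le)).trans (ball_subset_closedBall.trans hRO), key⟩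

end Chart

/-! ### The named fact from the Evans–Krylov chart estimate -/

section Reduction

/-- **`gurskyViaclovsky_pathClosed_weighted_four` follows from a uniform chart `C^{2,α}` Hölder
bound.** Hypothesis `hC2α`: on a closed Riemannian `4`-manifold, for every `C²`-bounded sequence
of smooth admissible background solutions `u_k` at parameters `s_k → t`, `s_k ≤ 1`
(`backgroundPathOperator g s_k (−u_k) = q e^{4u_k}`, `backgroundScalar g (−u_k) > 0`,
`|u_k|, |∇u_k|²_g, |∇²u_k|²_g ≤ C`), every point has a chart ball on which the second derivatives
of the representatives `u_k ∘ (chartAt x)⁻¹` are `α`-Hölder, `0 < α < 1`, uniformly in `k` — the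
interior Evans–Krylov estimate for this concave uniformly elliptic equation (Gursky–Viaclovsky's
Prop. 6: "the `C²` estimate implies uniform ellipticity, and the `C^{2,α}` estimate then follows
from the work of [Krylov] and [Evans]"; Gilbarg–Trudinger Thm. 17.14), NOT proved in the tree and
not vended as a fact. Conclusion: the named fact, by the Schauder bootstrap in the charts
(`chart_uniform_bounds_of_holderOnWith_two`, Gilbarg–Trudinger Lemma 17.16, proved) and the
reduction `pathClosed_of_chartHigherBounds` (Arzelà–Ascoli extraction and the limit argument).
[cite: GurskyViaclovsky2003, Prop. 6 and §5 (proof of Thm. 1)] -/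
theorem pathClosed_of_chartC2alphaBounds
    (hC2α : ∀ (M : Type) [TopologicalSpace M] [T2Space M] [SecondCountableTopology M]
      [ChartedSpace (EuclideanSpace ℝ (Fin 4)) M] [IsManifold (𝓡 4) ∞ M]
      [CompactSpace M] [ConnectedSpace M]
      (g : PseudoRiemannianMetric (𝓡 4) ∞ (EuclideanSpace ℝ (Fin 4))
        (TangentSpace (𝓡 4) : M → Type _))
      [g.HasLeviCivita], g.IsRiemannian →
      ∀ (q : M → ℝ) (C : ℝ), ContMDiff (𝓡 4) 𝓘(ℝ) ∞ q → (∀ x, 0 < q x) →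
      ∀ (s : ℕ → ℝ) (t : ℝ), Tendsto s atTop (𝓝 t) → (∀ k, s k ≤ 1) →
      ∀ (u : ℕ → M → ℝ), (∀ k, ContMDiff (𝓡 4) 𝓘(ℝ) ∞ (u k)) →
        (∀ k x, backgroundPathOperator g (s k) (fun y ↦ -u k y) x =
          q x * Real.exp (-4 * (-u k x))) →
        (∀ k x, 0 < backgroundScalar g (fun y ↦ -u k y) x) →
        (∀ k x, |u k x| ≤ C ∧ g.gradSq (u k) x ≤ C ∧ g.normSq x (g.hessian (u k) x) ≤ C) →
        ∀ x : M, ∃ r : ℝ, 0 < r ∧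
          ball (chartAt (EuclideanSpace ℝ (Fin 4)) x x) r ⊆
            (chartAt (EuclideanSpace ℝ (Fin 4)) x).target ∧
          ∃ α : NNReal, 0 < α ∧ α < 1 ∧ ∃ B : NNReal, ∀ k,
            HolderOnWith B α
              (iteratedFDeriv ℝ 2 (fun z ↦ u k ((chartAt (EuclideanSpace ℝ (Fin 4)) x).symm z)))
              (ball (chartAt (EuclideanSpace ℝ (Fin 4)) x x) r)) :
    gurskyViaclovsky_pathClosed_weighted_four := by
  refine pathClosed_of_chartHigherBounds fun M _ _ _ _ _ _ _ g _ hg q C hq hq0 s t hs hs1 u hu heq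
    hpos hbd x ↦ ?_
  obtain ⟨r₁, hr₁, -, α, hα0, hα1, BH, hho⟩ :=
    hC2α M g hg q C hq hq0 s t hs hs1 u hu heq hpos hbd x
  obtain ⟨r, hr, hrT, hB⟩ := chart_uniform_bounds_of_holderOnWith_two g hg hq hq0 hs hs1 hu heq
    hpos hbd x hr₁ hα0 hα1 hho
  exact ⟨r, hr, hrT, fun m _ ↦ hB m⟩

end Reduction

end Literature.Geometry.Riemannian.GurskyViaclovskyPath

end
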